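import Literature.Topology.FourManifolds.Collapsible
import Mathlib.Topology.MetricSpace.HausdorffDimension
import Mathlib.LinearAlgebra.AffineSpace.FiniteDimensional
import HarnessLib

/-!
# Faces of a smoothly embedded complex covering an open set of the manifold lie in
# top-dimensional faces

Topic `Literature/Topology/FourManifolds`; a step of the proof of the named fact
`Literature.Topology.FourManifolds.exists_isSmoothEmbedding_closedBall_of_isSmoothlyCollapsible`
(`Collapsible.lean`; Hirsch 1962).  Let `f : E^N → M` be a smooth non-degenerate embedding of the
finite Euclidean complex `K` into the smooth `(n+1)`-manifold `M`
(`Literature.Topology.FourManifolds.IsSmoothComplexEmbedding`, Munkres 1966, Def. 8.1/8.3).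

* `IsSmoothComplexEmbedding.card_le_of_mem_faces` — every face has at most `n + 2` vertices
  (the differential of the smooth extension is injective on the direction space of the face,
  a space of dimension `card - 1`, and takes values in a tangent space of dimension `n + 1`);
* `IsSmoothComplexEmbedding.interior_image_convexHull_eq_empty` — the image of a face with at
  most `n + 1` vertices has empty interior in `M` (in a chart it is, locally, a `C¹` image of a
  set of Hausdorff dimension `≤ n < n + 1`, whose complement is dense:
  `ContDiffOn.dimH_image_le`, `dense_compl_of_dimH_lt_finrank`);
* `IsSmoothComplexEmbedding.exists_face_card_eq_of_image_subset_interior` — **a face `τ` whose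
  image lies in the interior of `f(|K|)` is a face of a face with exactly `n + 2` vertices**:
  by the two facts above and Baire-free finite-union bookkeeping every point of `conv τ` lies in
  a top-dimensional simplex `conv ρ`, hence (intersection axiom) in `conv (ρ ∩ τ)`; if no such
  `ρ` contained `τ`, the barycentre of `τ` would lie in the hull of a proper subset of the
  vertices of `τ`, contradicting affine independence
  (`sum_smul_notMem_convexHull_of_ssubset`).

This is the (elementary) part of "a `C^r` triangulated `m`-manifold is pure of dimension `m`"
needed by the induction on collapses.  Everything here is proved; no definitions, no named facts.

## References

* J. R. Munkres, *Elementary differential topology*, Ann. of Math. Studies 54 (rev. 1966), §8.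
  [Munkres1966]
* M. W. Hirsch, *Smooth regular neighborhoods*, Ann. of Math. (2) 76 (1962) 524–530. [Hirsch1962]
-/

open scoped Manifold ContDiff Topology ENNReal
open Set Function Module

noncomputable section

namespace Literature.Topology.FourManifolds

universe u

/-! ### Barycentres and proper subsets of the vertices -/

/-- **The barycentre of an affinely independent finite set is not in the convex hull of a proper
subset of it** (its barycentric coordinates are all nonzero). [folklore] -/
theorem sum_smul_notMem_convexHull_of_ssubset {E : Type*} [AddCommGroup E] [Module ℝ E]
    {τ S : Finset E} (hind : AffineIndependent ℝ ((↑) : τ → E)) (hS : S ⊆ τ) (hne : S ≠ τ) :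
    (∑ y ∈ τ, ((τ.card : ℝ)⁻¹) • y) ∉ convexHull ℝ (S : Set E) := by
  classical
  intro hc
  rw [Finset.mem_convexHull'] at hc
  obtain ⟨w, -, hw1, hwc⟩ := hc
  obtain ⟨v, hvτ, hvS⟩ := Finset.exists_of_ssubset (Finset.ssubset_iff_subset_ne.2 ⟨hS, hne⟩)
  have hτne : τ.Nonempty := ⟨v, hvτ⟩
  have hcard : (τ.card : ℝ) ≠ 0 := Nat.cast_ne_zero.2 (Finset.card_pos.2 hτne).ne'
  set w' : E → ℝ := fun y => (τ.card : ℝ)⁻¹ - if y ∈ S then w y else 0 with hw'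
  have hinter : τ ∩ S = S := Finset.inter_eq_right.2 hS
  have h1 : ∑ y ∈ τ, w' y = 0 := by
    simp only [hw', Finset.sum_sub_distrib, Finset.sum_const, nsmul_eq_mul, Finset.sum_ite_mem,
      hinter, hw1]
    rw [mul_inv_cancel₀ hcard, sub_self]
  have h2 : ∑ y ∈ τ, w' y • y = 0 := by
    simp only [hw', sub_smul, Finset.sum_sub_distrib, ite_smul, zero_smul, Finset.sum_ite_mem,
      hinter, hwc, sub_self]
  have hzero := hind.eq_zero_of_sum_eq_zero_subtype h1 h2 v hvτ
  simp only [hw', hvS, if_false, sub_zero, inv_eq_zero] at hzero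
  exact hcard hzero

/-- The barycentre of a nonempty finite set lies in its convex hull. [folklore] -/
theorem sum_smul_mem_convexHull {E : Type*} [AddCommGroup E] [Module ℝ E] {τ : Finset E}
    (hτ : τ.Nonempty) : (∑ y ∈ τ, ((τ.card : ℝ)⁻¹) • y) ∈ convexHull ℝ (τ : Set E) := by
  have hcard : (τ.card : ℝ) ≠ 0 := Nat.cast_ne_zero.2 (Finset.card_pos.2 hτ).ne'
  refine Finset.mem_convexHull'.2 ⟨fun _ => (τ.card : ℝ)⁻¹, fun _ _ => by positivity, ?_, rfl⟩
  rw [Finset.sum_const, nsmul_eq_mul, mul_inv_cancel₀ hcard]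

/-! ### Finite unions of closed sets with empty interior -/

/-- A finite union of closed sets with empty interior has empty interior. [folklore] -/
theorem interior_biUnion_finset_eq_empty {X ι : Type*} [TopologicalSpace X] (T : Finset ι)
    (S : ι → Set X) (hc : ∀ i ∈ T, IsClosed (S i)) (he : ∀ i ∈ T, interior (S i) = ∅) :
    interior (⋃ i ∈ T, S i) = ∅ := by
  classical
  induction T using Finset.induction_on with
  | empty => simp
  | insert a T ha ih =>
    have hc' : ∀ i ∈ T, IsClosed (S i) := fun i hi => hc i (Finset.mem_insert_of_mem hi)
    have he' : ∀ i ∈ T, interior (S i) = ∅ := fun i hi => he i (Finset.mem_insert_of_mem hi)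
    rw [Finset.set_biUnion_insert, union_comm,
      interior_union_isClosed_of_interior_empty (isClosed_biUnion_finset hc')
        (he a (Finset.mem_insert_self a T))]
    exact ih hc' he'

/-! ### Faces of a smoothly embedded complex -/

section Faces

variable {n N : ℕ} {M : Type u} [TopologicalSpace M] [T2Space M]
  [ChartedSpace (EuclideanSpace ℝ (Fin (n + 1))) M] [IsManifold (𝓡 (n + 1)) ∞ M]
  {K : Geometry.SimplicialComplex ℝ (EuclideanSpace ℝ (Fin N))}
  {f : EuclideanSpace ℝ (Fin N) → M}

/-- The direction space of a face with `k` vertices has dimension `k - 1`. [folklore] -/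
theorem finrank_vectorSpan_of_mem_faces {ρ : Finset (EuclideanSpace ℝ (Fin N))}
    (hρ : ρ ∈ K.faces) :
    finrank ℝ (vectorSpan ℝ (ρ : Set (EuclideanSpace ℝ (Fin N)))) = ρ.card - 1 := by
  have hne := K.nonempty_of_mem_faces hρ
  have hcard : Fintype.card ρ = (ρ.card - 1) + 1 := by
    rw [Fintype.card_coe, Nat.sub_add_cancel (Finset.card_pos.2 hne)]
  have h := (K.indep hρ).finrank_vectorSpan hcard
  rwa [Subtype.range_coe_subtype] at h

omit [T2Space M] [IsManifold (𝓡 (n + 1)) ∞ M] in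
/-- **Faces of a smoothly embedded complex have at most `n + 2` vertices**: the differential of
the smooth extension of `f|conv ρ` at a point of `conv ρ` is injective on the direction space of
`ρ` (dimension `card ρ - 1`) with values in a tangent space of `M` (dimension `n + 1`).
[cite: Munkres1966, Def. 8.1] -/
theorem IsSmoothComplexEmbedding.card_le_of_mem_faces (hf : IsSmoothComplexEmbedding (n + 1) K f)
    {ρ : Finset (EuclideanSpace ℝ (Fin N))} (hρ : ρ ∈ K.faces) : ρ.card ≤ n + 2 := by
  obtain ⟨g, u, -, -, -, -, hinj⟩ := hf.2.2 ρ hρ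
  have hne := K.nonempty_of_mem_faces hρ
  obtain ⟨x, hx⟩ : (convexHull ℝ (ρ : Set (EuclideanSpace ℝ (Fin N)))).Nonempty :=
    ⟨_, subset_convexHull ℝ _ (Finset.mem_coe.2 hne.choose_spec)⟩
  set D := mfderiv 𝓘(ℝ, EuclideanSpace ℝ (Fin N)) (𝓡 (n + 1)) g x with hD
  set Wv := vectorSpan ℝ (ρ : Set (EuclideanSpace ℝ (Fin N))) with hWv
  -- the restriction of `D` to the direction space, as a linear map into `ℝⁿ⁺¹`
  let D₀ : EuclideanSpace ℝ (Fin N) →ₗ[ℝ] EuclideanSpace ℝ (Fin (n + 1)) := D.toLinearMap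
  let D' : Wv →ₗ[ℝ] EuclideanSpace ℝ (Fin (n + 1)) := D₀.comp Wv.subtype
  have hD' : Injective D' := by
    intro a b hab
    have hab' : D (a : EuclideanSpace ℝ (Fin N)) = D (b : EuclideanSpace ℝ (Fin N)) := hab
    exact Subtype.ext (hinj x hx a.2 b.2 hab')
  have hle := LinearMap.finrank_le_finrank_of_injective hD'
  rw [finrank_euclideanSpace_fin, hWv, finrank_vectorSpan_of_mem_faces hρ] at hle
  have := Finset.card_pos.2 hne
  omega

omit [T2Space M] [IsManifold (𝓡 (n + 1)) ∞ M] in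
/-- A smooth complex embedding is injective on the polyhedron. [folklore] -/
theorem IsSmoothComplexEmbedding.injOn_space' (hf : IsSmoothComplexEmbedding (n + 1) K f) :
    InjOn f K.space :=
  injOn_iff_injective.2 hf.2.1.injective

/-- **The image of a face with at most `n + 1` vertices has empty interior in `M`.**  Near a
point `x₀ ∈ conv ρ`, read in a chart `c` at `f x₀`, `f|conv ρ` is the restriction of the `C^∞`
map `c ∘ g` (`g` the smooth extension), and `conv ρ` has Hausdorff dimension `card ρ - 1 ≤ n`, so
its image has Hausdorff dimension `< n + 1` and dense complement in `ℝⁿ⁺¹`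
(`ContDiffOn.dimH_image_le`, `dense_compl_of_dimH_lt_finrank`); an interior point of
`f(conv ρ)` would give (removing the compact image of `conv ρ` minus a ball about `x₀`) a nonempty
open subset of that image. [cite: Munkres1966, §8] -/
theorem IsSmoothComplexEmbedding.interior_image_convexHull_eq_empty
    (hf : IsSmoothComplexEmbedding (n + 1) K f) {ρ : Finset (EuclideanSpace ℝ (Fin N))}
    (hρ : ρ ∈ K.faces) (hcard : ρ.card ≤ n + 1) :
    interior (f '' convexHull ℝ (ρ : Set (EuclideanSpace ℝ (Fin N)))) = ∅ := by
  obtain ⟨g, u, hu, hsub, hg, hfg, -⟩ := hf.2.2 ρ hρ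
  by_contra hne
  obtain ⟨z, hz⟩ := nonempty_iff_ne_empty.2 hne
  obtain ⟨x₀, hx₀, rfl⟩ := interior_subset hz
  set Cρ : Set (EuclideanSpace ℝ (Fin N)) := convexHull ℝ (ρ : Set (EuclideanSpace ℝ (Fin N)))
    with hCρ
  have hCρc : IsCompact Cρ := ρ.finite_toSet.isCompact_convexHull ℝ
  have hCρK : Cρ ⊆ K.space := K.convexHull_subset_space hρ
  -- the chart at `f x₀` and the smooth map `F = c ∘ g` near `x₀`
  set c := chartAt (EuclideanSpace ℝ (Fin (n + 1))) (f x₀) with hc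
  set O : Set (EuclideanSpace ℝ (Fin N)) := u ∩ g ⁻¹' c.source with hO
  have hOo : IsOpen O := hg.continuousOn.isOpen_inter_preimage hu c.open_source
  have hgx₀ : g x₀ = f x₀ := (hfg x₀ hx₀).symm
  have hx₀O : x₀ ∈ O := ⟨hsub hx₀, by rw [mem_preimage, hgx₀]; exact mem_chart_source _ _⟩
  set F : EuclideanSpace ℝ (Fin N) → EuclideanSpace ℝ (Fin (n + 1)) := c ∘ g with hF
  have hFm : ContMDiffOn 𝓘(ℝ, EuclideanSpace ℝ (Fin N)) (𝓡 (n + 1)) ∞ F O :=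
    (contMDiffOn_chart (x := f x₀)).comp (hg.mono inter_subset_left) fun x hx => hx.2
  have hFd : ContDiffOn ℝ ∞ F O := contMDiffOn_iff_contDiffOn.1 hFm
  obtain ⟨r, hr, hball⟩ := Metric.isOpen_iff.1 hOo x₀ hx₀O
  -- the piece of the simplex near `x₀` has image of Hausdorff dimension `< n + 1`
  set t : Set (EuclideanSpace ℝ (Fin N)) := Cρ ∩ Metric.ball x₀ r with ht
  have hdim : dimH (F '' t) < finrank ℝ (EuclideanSpace ℝ (Fin (n + 1))) := by
    have h1 : dimH (F '' t) ≤ dimH t :=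
      ((hFd.mono hball).of_le (by exact_mod_cast le_top)).dimH_image_le (convex_ball x₀ r)
        inter_subset_right
    have h2 : dimH t ≤ dimH Cρ := dimH_mono inter_subset_left
    have h3 : dimH Cρ = (ρ.card - 1 : ℕ) := by
      rw [hCρ, Real.Convex.dimH_eq_finrank_vectorSpan (convex_convexHull ℝ _) ⟨x₀, hx₀⟩,
        ← direction_affineSpan, affineSpan_convexHull, direction_affineSpan,
        finrank_vectorSpan_of_mem_faces hρ]
    rw [finrank_euclideanSpace_fin]
    calc dimH (F '' t) ≤ (ρ.card - 1 : ℕ) := (h1.trans h2).trans h3.le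
      _ < ((n + 1 : ℕ) : ℝ≥0∞) := by exact_mod_cast (by omega : ρ.card - 1 < n + 1)
  have hdense : Dense (F '' t)ᶜ := dense_compl_of_dimH_lt_finrank hdim
  -- the open set `Ω = interior f(conv ρ) ∖ f(conv ρ ∖ B(x₀, r))` contains `f x₀`
  set R : Set M := f '' (Cρ \ Metric.ball x₀ r) with hR
  have hRc : IsClosed R :=
    ((hCρc.diff Metric.isOpen_ball).image_of_continuousOn
      (hf.continuousOn.mono (Set.sdiff_subset.trans hCρK))).isClosed
  set Ω : Set M := interior (f '' Cρ) \ R with hΩ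
  have hΩo : IsOpen Ω := isOpen_interior.sdiff hRc
  have hzΩ : f x₀ ∈ Ω := by
    refine ⟨hz, ?_⟩
    rintro ⟨x, ⟨hxC, hxb⟩, hfx⟩
    have : x = x₀ := hf.injOn_space' (hCρK hxC) (hCρK hx₀) hfx
    exact hxb (this ▸ Metric.mem_ball_self hr)
  -- `Ω` lies in the chart source and `c(Ω) ⊆ F(t)`
  have hΩ' : ∀ w ∈ Ω, ∃ x ∈ t, w = g x := by
    rintro w ⟨hw, hwR⟩
    obtain ⟨x, hxC, rfl⟩ := interior_subset hw
    have hxb : x ∈ Metric.ball x₀ r := by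
      by_contra hxb
      exact hwR ⟨x, ⟨hxC, hxb⟩, rfl⟩
    exact ⟨x, ⟨hxC, hxb⟩, hfg x hxC⟩
  have hΩsrc : Ω ⊆ c.source := by
    intro w hw
    obtain ⟨x, hxt, rfl⟩ := hΩ' w hw
    exact (hball hxt.2).2
  have hcΩ : c '' Ω ⊆ F '' t := by
    rintro _ ⟨w, hw, rfl⟩
    obtain ⟨x, hxt, rfl⟩ := hΩ' w hw
    exact ⟨x, hxt, rfl⟩
  have hopen : IsOpen (c '' Ω) := c.isOpen_image_of_subset_source hΩo hΩsrc
  obtain ⟨p, hp1, hp2⟩ := hdense.exists_mem_open hopen ⟨c (f x₀), mem_image_of_mem c hzΩ⟩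
  exact hp1 (hcΩ hp2)

/-- **Every point of a face lying over the interior of `f(|K|)` is in a top-dimensional face**:
if `x ∈ |K|` and `f x` is an interior point of `f(|K|)`, then `x ∈ conv ρ` for a face `ρ` with
`n + 2` vertices (the images of the faces with fewer vertices form a closed set with empty
interior, `interior_image_convexHull_eq_empty`, and the images of the top faces a closed set).
[cite: Munkres1966, §8] -/
theorem IsSmoothComplexEmbedding.exists_mem_convexHull_card_eq
    (hf : IsSmoothComplexEmbedding (n + 1) K f) {x : EuclideanSpace ℝ (Fin N)} (hx : x ∈ K.space)
    (hint : f x ∈ interior (f '' K.space)) :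
    ∃ ρ ∈ K.faces, ρ.card = n + 2 ∧ x ∈ convexHull ℝ (ρ : Set (EuclideanSpace ℝ (Fin N))) := by
  classical
  set Fc : Finset (Finset (EuclideanSpace ℝ (Fin N))) := hf.1.toFinset with hFc
  have hmemFc : ∀ ρ, ρ ∈ Fc ↔ ρ ∈ K.faces := fun ρ => by simp [hFc]
  set Top := Fc.filter fun ρ => ρ.card = n + 2 with hTop
  set Low := Fc.filter fun ρ => ρ.card ≤ n + 1 with hLow
  set S : Finset (EuclideanSpace ℝ (Fin N)) → Set M := fun ρ =>
    f '' convexHull ℝ (ρ : Set (EuclideanSpace ℝ (Fin N))) with hS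
  have hSc : ∀ ρ ∈ K.faces, IsClosed (S ρ) := fun ρ hρ =>
    ((ρ.finite_toSet.isCompact_convexHull ℝ).image_of_continuousOn
      (hf.continuousOn.mono (K.convexHull_subset_space hρ))).isClosed
  set T : Set M := ⋃ ρ ∈ Top, S ρ with hT
  set L : Set M := ⋃ ρ ∈ Low, S ρ with hL
  have hTc : IsClosed T :=
    isClosed_biUnion_finset fun ρ hρ => hSc ρ ((hmemFc ρ).1 (Finset.mem_filter.1 hρ).1)
  have hLint : interior L = ∅ :=
    interior_biUnion_finset_eq_empty Low S
      (fun ρ hρ => hSc ρ ((hmemFc ρ).1 (Finset.mem_filter.1 hρ).1))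
      fun ρ hρ => hf.interior_image_convexHull_eq_empty ((hmemFc ρ).1 (Finset.mem_filter.1 hρ).1)
        (Finset.mem_filter.1 hρ).2
  -- `f x ∈ T`
  have hxT : f x ∈ T := by
    by_contra hxT
    set V : Set M := interior (f '' K.space) \ T with hV
    have hVo : IsOpen V := isOpen_interior.sdiff hTc
    have hxV : f x ∈ V := ⟨hint, hxT⟩
    have hVL : V ⊆ L := by
      rintro w ⟨hw, hwT⟩
      obtain ⟨y, hy, rfl⟩ := interior_subset hw
      obtain ⟨ρ, hρ, hyρ⟩ := Geometry.SimplicialComplex.mem_space_iff.1 hy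
      have hle := hf.card_le_of_mem_faces hρ
      rcases hle.lt_or_eq with hlt | heq
      · exact mem_iUnion₂.2 ⟨ρ, Finset.mem_filter.2 ⟨(hmemFc ρ).2 hρ, by omega⟩,
          mem_image_of_mem f hyρ⟩
      · exact absurd (mem_iUnion₂.2 ⟨ρ, Finset.mem_filter.2 ⟨(hmemFc ρ).2 hρ, heq⟩,
          mem_image_of_mem f hyρ⟩) hwT
    have hsub : V ⊆ interior L := interior_maximal hVL hVo
    rw [hLint] at hsub
    exact hsub hxV
  obtain ⟨ρ, hρ, hxρ⟩ := mem_iUnion₂.1 hxT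
  obtain ⟨y, hy, hxy⟩ := hxρ
  have hρK : ρ ∈ K.faces := (hmemFc ρ).1 (Finset.mem_filter.1 hρ).1
  have : y = x := hf.injOn_space' (K.convexHull_subset_space hρK hy) hx hxy
  exact ⟨ρ, hρK, (Finset.mem_filter.1 hρ).2, this ▸ hy⟩

/-- **A face over the interior of `f(|K|)` is a face of a top-dimensional face.**  If the image
of the face `τ` lies in the interior of `f(|K|)`, there is a face `ρ ⊇ τ` with exactly `n + 2`
vertices: every point of `conv τ` lies in `conv ρ ∩ conv τ = conv (ρ ∩ τ)` for some top face `ρ`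
(`exists_mem_convexHull_card_eq`, intersection axiom), and the barycentre of `τ` lies in no
`conv S`, `S ⊊ τ` (`sum_smul_notMem_convexHull_of_ssubset`). [cite: Munkres1966, §8] -/
theorem IsSmoothComplexEmbedding.exists_face_card_eq_of_image_subset_interior
    (hf : IsSmoothComplexEmbedding (n + 1) K f) {τ : Finset (EuclideanSpace ℝ (Fin N))}
    (hτ : τ ∈ K.faces)
    (hint : f '' convexHull ℝ (τ : Set (EuclideanSpace ℝ (Fin N))) ⊆ interior (f '' K.space)) :
    ∃ ρ ∈ K.faces, τ ⊆ ρ ∧ ρ.card = n + 2 := by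
  classical
  have hτne := K.nonempty_of_mem_faces hτ
  set b : EuclideanSpace ℝ (Fin N) := ∑ y ∈ τ, ((τ.card : ℝ)⁻¹) • y with hb
  have hbτ : b ∈ convexHull ℝ (τ : Set (EuclideanSpace ℝ (Fin N))) := sum_smul_mem_convexHull hτne
  have hbK : b ∈ K.space := K.convexHull_subset_space hτ hbτ
  obtain ⟨ρ, hρ, hcard, hbρ⟩ :=
    hf.exists_mem_convexHull_card_eq hbK (hint (mem_image_of_mem f hbτ))
  refine ⟨ρ, hρ, ?_, hcard⟩
  by_contra hτρ
  have hmem : b ∈ convexHull ℝ ((ρ ∩ τ : Finset _) : Set (EuclideanSpace ℝ (Fin N))) := by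
    rw [Finset.coe_inter, ← Geometry.SimplicialComplex.convexHull_inter_convexHull hρ hτ]
    exact ⟨hbρ, hbτ⟩
  refine sum_smul_notMem_convexHull_of_ssubset (K.indep hτ) Finset.inter_subset_right ?_ hmem
  intro h
  exact hτρ (h ▸ Finset.inter_subset_left)

end Faces

end Literature.Topology.FourManifolds
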